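import Summits.ValiantsHypothesis.ValiantsHypothesis.Theorems.KPlusLogSqLawTropicalBFatShortCycles
import Summits.ValiantsHypothesis.ValiantsHypothesis.Theorems.KPlusLogSqLawTropicalBThinStubIffLongCycles

/-!
# Route «KPlusLogSqLaw», crux `TropicalB` (stmt-ValiantsHypothesis-19771) — `TropicalB` ⟺ FEW LONG EXCHANGE CYCLES
# (long = more than `max(⌊log₂ m⌋, K/⌊log₂ m⌋)` columns)

HONEST FRAMING.  Helper toward the registered stubs `stub_tropThin` / `stub_tropFat` of `Cruxes/TropicalB/Lines/birth.lean` (crux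
`Summit.ValiantsHypothesis.ValiantsHypothesis.Theses.KPlusLogSqLaw.TropicalB`, item stmt-ValiantsHypothesis-19771, route KPlusLogSqLaw; cell `pub-symmetroid`, seat
val-sym-trop-p1 g25, 2026-08-29; `--supports … --as helper`).  A REFORMULATION (kernel iff) of the OPEN crux; nothing is asserted about `TropicalB`, and nothing
bears on `WeakLifting`, DoorA26 / DoorA34, `MatrixDescartes` (stmt-ValiantsHypothesis-18050) or VP ≠ VNP.

* **`tropicalB_iff_fewLongCycles`** — `TropicalB` holds iff there is `C` such that in every design of every format `(m, K)` every UNSIGNED dominant chain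
  (strictly increasing slopes, consecutive terms distinct) has at most `2^(C·(K + ⌊log₂ m⌋²))` steps whose exchange quotient `σ_k⁻¹σ_{k+1}` has an orbit of
  MORE THAN `max(⌊log₂ m⌋, K/⌊log₂ m⌋)` columns (formally: not every column lies in an invariant set of at most that many columns).
  (→) `tropicalB_iff_unsigned` (such steps are steps).  (←) three regimes: `m ≤ K` is slope counting (`tropRootLawAt_fatEnd`, via `tropRowD_of_tropRootLawAt`);
  `K ≤ ⌊log₂ m⌋²` is the thin log-cycle sector `chain_le_thin_logCycles_of_exceptions` (`n ≤ #J + 2^(8⌊log₂ m⌋²)`); `⌊log₂ m⌋² < K < m` is the fat twin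
  `chain_le_fat_shortCycles_of_exceptions` (`n ≤ #J + 2^(8K)`); the constant produced is `C + 9`.
So, by the LOCAL PATTERN LAW, the crux is EXACTLY a `2^{O(K + log² m)}` budget for the exchanges along cycles longer than `max(log₂ m, K/log₂ m)` — every
shorter cycle is paid for by the polynomial site count, in every design and for all exponents.
[this cell's law]
-/

set_option linter.dupNamespace false
set_option autoImplicit false

namespace Summit.ValiantsHypothesis.ValiantsHypothesis.Theorems.KPlusLogSqLaw

open Summit.ValiantsHypothesis.ValiantsHypothesis.Theorems.MatrixDescartes.Negative
open Summit.ValiantsHypothesis.ValiantsHypothesis.Theorems.LacunarySymmetroidMatrixDescartes.TropicalCensus (tropRootLawAt_fatEnd)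
open Summit.ValiantsHypothesis.ValiantsHypothesis.Theses.KPlusLogSqLaw (TropicalB)
open scoped BigOperators
open Finset

namespace LocalPattern

/-- **`TropicalB` ⟺ few long exchange cycles** (long = more than `max(⌊log₂ m⌋, K/⌊log₂ m⌋)` columns). [this cell's law] -/
theorem tropicalB_iff_fewLongCycles :
    TropicalB ↔ ∃ C : ℕ, ∀ (m K : ℕ) (d : Fin K → ℕ) (v ε : Fin m → Fin m → Fin K → ℤ) (n : ℕ) (θ : Fin (n + 1) → ℤ)
      (p : Fin (n + 1) → Equiv.Perm (Fin m) × (Fin m → Fin K)),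
      StrictMono θ → (∀ k, IsDominant d v ε (θ k) (p k)) → (∀ k : Fin n, p k.castSucc ≠ p k.succ) →
      (univ.filter fun k : Fin n => ¬ ∀ b : Fin m, ∃ T : Finset (Fin m), b ∈ T ∧
        T.card ≤ max (Nat.log 2 m) (K / Nat.log 2 m) ∧ ∀ x, ((p k.castSucc).1⁻¹ * (p k.succ).1) x ∈ T ↔ x ∈ T).card ≤
        2 ^ (C * (K + Nat.log 2 m ^ 2)) := by
  classical
  rw [tropicalB_iff_unsigned]
  constructor
  · rintro ⟨C, hC⟩
    refine ⟨C, fun m K d v ε n θ p hθ hdom hne => ?_⟩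
    have hn : n ≤ 2 ^ (C * (K + Nat.log 2 m ^ 2)) := hC m K d v ε n θ p hθ hdom hne
    exact (card_le_univ _).trans (by rw [Fintype.card_fin]; exact hn)
  · rintro ⟨C, hC⟩
    refine ⟨C + 9, fun m K d v ε n θ p hθ hdom hne => ?_⟩
    set L := Nat.log 2 m with hL
    set X := K + L ^ 2 with hX
    set J : Finset (Fin n) := univ.filter fun k : Fin n => ¬ ∀ b : Fin m, ∃ T : Finset (Fin m), b ∈ T ∧
        T.card ≤ max L (K / L) ∧ ∀ x, ((p k.castSucc).1⁻¹ * (p k.succ).1) x ∈ T ↔ x ∈ T with hJ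
    have hJC : J.card ≤ 2 ^ (C * X) := hC m K d v ε n θ p hθ hdom hne
    have horb : ∀ k : Fin n, k ∉ J → ∀ b : Fin m, ∃ T : Finset (Fin m), b ∈ T ∧ T.card ≤ max L (K / L) ∧
        ∀ x, ((p k.castSucc).1⁻¹ * (p k.succ).1) x ∈ T ↔ x ∈ T := by
      intro k hk
      by_contra h
      exact hk (mem_filter.mpr ⟨mem_univ _, h⟩)
    -- absorbing `2^(C X) + 2^(8 Y) ≤ 2^((C+9) X)` for `Y ≤ X`, `1 ≤ X`
    have absorb : ∀ Y : ℕ, Y ≤ X → 1 ≤ X → 2 ^ (C * X) + 2 ^ (8 * Y) ≤ 2 ^ ((C + 9) * X) := by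
      intro Y hY hX1
      have h1 : 2 ^ (C * X) ≤ 2 ^ ((C + 8) * X) := Nat.pow_le_pow_right (by norm_num) (by nlinarith)
      have h2 : 2 ^ (8 * Y) ≤ 2 ^ ((C + 8) * X) := Nat.pow_le_pow_right (by norm_num) (by nlinarith)
      have h3 : 2 ^ ((C + 8) * X) + 2 ^ ((C + 8) * X) = 2 ^ ((C + 8) * X + 1) := by rw [pow_succ]; ring
      have h4 : 2 ^ ((C + 8) * X + 1) ≤ 2 ^ ((C + 9) * X) := Nat.pow_le_pow_right (by norm_num) (by nlinarith)
      omega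
    rcases Nat.eq_zero_or_pos K with hK0 | hKpos
    · -- no classes: `m = 0` or no class map; `n = 0`
      subst hK0
      have hn0 := eq_zero_of_no_classes p hne
      calc n = 0 := hn0
        _ ≤ _ := Nat.zero_le _
    have hX1 : 1 ≤ X := by omega
    rcases le_or_gt m K with hmK | hKm
    · -- super-fat corner: slope counting
      have hn : n ≤ 2 * 2 ^ (2 * K) := tropRowD_of_tropRootLawAt (tropRootLawAt_fatEnd hmK) d v ε n θ p hθ hdom hne
      calc n ≤ 2 * 2 ^ (2 * K) := hn
        _ = 2 ^ (2 * K + 1) := by rw [pow_succ]; ring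
        _ ≤ 2 ^ ((C + 9) * X) := Nat.pow_le_pow_right (by norm_num) (by nlinarith)
    · rcases le_or_gt K (L ^ 2) with hthin | hfat
      · -- thin window: long = more than `L` columns
        have hL1 : 1 ≤ L := by
          rcases Nat.eq_zero_or_pos L with h | h
          · rw [h] at hthin; omega
          · exact h
        have hmax : max L (K / L) = L := by
          apply max_eq_left
          calc K / L ≤ L ^ 2 / L := Nat.div_le_div_right hthin
            _ = L := by rw [sq, Nat.mul_div_cancel _ hL1]
        have horb' : ∀ k : Fin n, k ∉ J → ∀ b : Fin m, ∃ T : Finset (Fin m), b ∈ T ∧ T.card ≤ Nat.log 2 m ∧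
            ∀ x, ((p k.castSucc).1⁻¹ * (p k.succ).1) x ∈ T ↔ x ∈ T := by
          intro k hk b
          obtain ⟨T, hbT, hTc, hTinv⟩ := horb k hk b
          exact ⟨T, hbT, by rw [hmax] at hTc; exact hTc, hTinv⟩
        have hlaw := chain_le_thin_logCycles_of_exceptions d v ε hthin θ p hθ hdom hne J horb'
        rw [← hL] at hlaw
        have := absorb (L ^ 2) (by omega) hX1
        omega
      · -- fat window: long = more than `K / L` columns
        have hmax : max L (K / L) = K / L := by
          apply max_eq_right
          rcases Nat.eq_zero_or_pos L with h | h
          · rw [h]; exact Nat.zero_le _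
          · exact (Nat.le_div_iff_mul_le h).mpr (by nlinarith)
        have horb' : ∀ k : Fin n, k ∉ J → ∀ b : Fin m, ∃ T : Finset (Fin m), b ∈ T ∧ T.card ≤ K / Nat.log 2 m ∧
            ∀ x, ((p k.castSucc).1⁻¹ * (p k.succ).1) x ∈ T ↔ x ∈ T := by
          intro k hk b
          obtain ⟨T, hbT, hTc, hTinv⟩ := horb k hk b
          exact ⟨T, hbT, by rw [hmax] at hTc; exact hTc, hTinv⟩
        have hlaw := chain_le_fat_shortCycles_of_exceptions d v ε hKm.le θ p hθ hdom hne J horb'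
        have := absorb K (by omega) hX1
        omega

end LocalPattern

end Summit.ValiantsHypothesis.ValiantsHypothesis.Theorems.KPlusLogSqLaw
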